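import Mathlib
import Literature.NumberTheory.Irrationality.DirichletLValues.ChowlaMilnorLFunctionProofs
import HarnessLib

/-!
# The Dedekind-determinant step of Gun–Murty–Rath's Theorem 4: if every multiplicative twist `f_h` of a rational
# periodic `f` (prime period) has `L(k, f_h) = 0`, then `f` is the exceptional function

Topic `Literature/NumberTheory/Irrationality/DirichletLValues`. Proofs-only leaf (theorems only, no definition, no
named fact, no `sorry`; cell pub-zeta5, P1 g54), sequel of `ChowlaMilnorLFunctionProofs.lean` (P1 g53: eq. (1),
the p. 1329 display `pow_mul_LFunction_eq_sum_Ico`, Chowla–Chowla ⟺ Milnor).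

## Source (read on the page)

S. Gun, M. R. Murty, P. Rath, *On a conjecture of Chowla and Milnor*, Canad. J. Math. **63** (2011) 1328–1344
[GunRammurtyRath2011], §3, proof of **Theorem 4** («Assume that the polylog conjecture is true. Then the Chowla–Milnor
conjecture is true for all `q > 1` and `k > 1`»), pp. 1339–1341. After the polylogarithmic first half (which from
`L(k, f) = 0` and the Polylog conjecture derives, for every Galois conjugate, «`L(k, f_h) = Σ f_h(n)/n^k = 0` for all
`1 ≤ h ≤ p − 1`», `f_h(n) = f(nh^{−1})`) the proof concludes UNCONDITIONALLY: «This gives that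
`L(k, f_h) = p^{−k} Σ_{a=1}^{p−1} [f_h(a) + f_h(p)/(p^k − 1)] ζ(k, a/p) = 0` for all `1 ≤ h ≤ p − 1`. Now, making a change of
variable and noting that `f_h(p) = f(p)`, we have (4) `L(k, f_h) = p^{−k} Σ_{a=1}^{p−1} [f(a) + f(p)/(p^k − 1)] ζ(k, ah/p) = 0`
for all `1 ≤ h ≤ p − 1`. We treat this as a matrix equation with `B` being the `(p − 1) × (p − 1)` matrix whose
`(a, h)`-th entry is given by `ζ(k, ah/p)`. Then by the evaluation of the Dedekind determinant as in Lemma 3, we have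
`Det(B) = ± Π_χ p^k L(k, χ) ≠ 0`. Thus the matrix `B` is invertible and hence by the equation (4), we have
`f(a) + f(p)/(p^k − 1) = 0`, `1 ≤ a ≤ p − 1` and hence `f(1) = f(2) = ⋯ = f(p)/(1 − p^k)`.» (Lemma 3 = the Dedekind
determinant, [Lang, *Algebra*, p. 548].)

## What is proved

The kernel diagonalises the matrix `B` by the Dirichlet characters directly (Mathlib's orthogonality
`DirichletCharacter.sum_char_inv_mul_char_eq`) instead of quoting the determinant — the same computation:
* `sum_units_mul_hurwitzValue_eq_pow_mul_LFunction` — the eigenvalues: `Σ_{x ∈ (ℤ/p)^×} χ(x) ζ(k, x/p) = p^k L(k, χ)`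
  (eq. (1)), non-zero for `k ≥ 2` (`DirichletCharacter.LFunction_ne_zero_of_one_le_re`);
* **`eq_zero_of_forall_sum_twist_eq_zero`** — «`B` is invertible»: if `g : (ℤ/p)^× → ℂ` has
  `Σ_b g(b) ζ(k, (bh)/p) = 0` for every unit `h`, then `g = 0`;
* **`exceptional_of_forall_LFunction_twist_eq_zero`** — THE STEP: for a prime `p`, `k ≥ 2`, `f : ℤ/p → ℚ` with
  `L(k, f_h) = 0` for all units `h`, `f(a) = f(0)/(1 − p^k)` for all `a ≠ 0` (`f(p) = f(0)` in `ℤ/p`);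
  `forall_LFunction_twist_eq_zero_iff` — and conversely (the exceptional function is twist-invariant), an IFF.
The Polylog conjecture and Theorem 4 itself are NOT typed (the polylogarithmic half needs Galois conjugation of the
Fourier coefficients and `Li_k` at roots of unity).

HONEST FRAMING: an unconditional printed step made a kernel theorem; the Polylog and Chowla–Milnor conjectures stay
OPEN and untyped; nothing here concerns `ζ(5)`.
-/

noncomputable section

open Finset Complex

namespace Literature.NumberTheory.Irrationality.DirichletLValues

open Literature.NumberTheory.Transcendental ChowlaMilnorL

/-! ### The eigenvalues: character sums of Hurwitz values are `p^k L(k, χ)` -/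

/-- A sum over the units of `ℤ/p` of `χ(x)·F(x)` is the sum over all residues (`χ` vanishes off the units). [folklore] -/
private theorem sum_units_eq_sum_univ {p : ℕ} [NeZero p] (χ : DirichletCharacter ℂ p) (F : ZMod p → ℂ) :
    ∑ u : (ZMod p)ˣ, χ (u : ZMod p) * F u = ∑ a : ZMod p, χ a * F a := by
  have h := Finset.sum_map (Finset.univ : Finset (ZMod p)ˣ) ⟨((↑) : (ZMod p)ˣ → ZMod p), Units.val_injective⟩
    (fun a => χ a * F a)
  simp only [Function.Embedding.coeFn_mk] at h
  rw [← h]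
  refine Finset.sum_subset (Finset.subset_univ _) fun a _ ha => ?_
  have hna : ¬ IsUnit a := by
    intro hu
    apply ha
    obtain ⟨u, rfl⟩ := hu
    exact Finset.mem_map.2 ⟨u, Finset.mem_univ _, rfl⟩
  rw [χ.map_nonunit hna, zero_mul]

/-- **`Σ_{x ∈ (ℤ/p)^×} χ(x) ζ(k, x/p) = p^k · L(k, χ)`** for a Dirichlet character `χ` mod `p` and `k ≥ 2` (eq. (1) with
`χ(p) = 0`; these are the eigenvalues of the matrix `B = (ζ(k, ah/p))` — «`Det(B) = ± Π_χ p^k L(k, χ)`»).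
[cite: GunRammurtyRath2011, eq. (1) (p. 1328) and proof of Theorem 4 (p. 1340, Det(B))] -/
theorem sum_units_mul_hurwitzValue_eq_pow_mul_LFunction {p : ℕ} [NeZero p] {k : ℕ} (hk : 2 ≤ k)
    (χ : DirichletCharacter ℂ p) :
    ∑ u : (ZMod p)ˣ, χ (u : ZMod p) * ((hurwitzValue k ((((u : ZMod p).val : ℕ) : ℝ) / p) : ℝ) : ℂ) =
      (p : ℂ) ^ k * χ.LFunction k := by
  have hp0 : (p : ℂ) ≠ 0 := by exact_mod_cast NeZero.ne p
  rw [sum_units_eq_sum_univ χ (fun a => ((hurwitzValue k (((a.val : ℕ) : ℝ) / p) : ℝ) : ℂ)),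
    DirichletCharacter.LFunction, LFunction_natCast_eq_sum_hurwitzValue hk, ← mul_assoc,
    mul_one_div_cancel (pow_ne_zero _ hp0), one_mul]
  -- `Σ_{a : ZMod p} G(a.val) = Σ_{a < p} G(a)`
  obtain ⟨n, rfl⟩ : ∃ n, p = n + 1 := ⟨p - 1, (Nat.succ_pred_eq_of_ne_zero (NeZero.ne p)).symm⟩
  have hfin : (∑ a : ZMod (n + 1), χ ((a.val : ℕ) : ZMod (n + 1)) *
      ((hurwitzValue k (((a.val : ℕ) : ℝ) / ((n + 1 : ℕ) : ℝ)) : ℝ) : ℂ)) =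
      ∑ i ∈ range (n + 1), χ (i : ZMod (n + 1)) * ((hurwitzValue k ((i : ℝ) / ((n + 1 : ℕ) : ℝ)) : ℝ) : ℂ) :=
    Fin.sum_univ_eq_sum_range (fun i : ℕ => χ (i : ZMod (n + 1)) *
      ((hurwitzValue k ((i : ℝ) / ((n + 1 : ℕ) : ℝ)) : ℝ) : ℂ)) (n + 1)
  rw [← hfin]
  refine Finset.sum_congr rfl fun a _ => ?_
  rw [ZMod.natCast_zmod_val]

/-! ### «`B` is invertible»: diagonalisation by characters -/

/-- **The matrix `B = (ζ(k, bh/p))_{b,h}` over the units of `ℤ/p` has trivial kernel** (`p` prime, `k ≥ 2`): if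
`Σ_b g(b) ζ(k, (bh)/p) = 0` for every unit `h`, then `g = 0`. Proof: for each character `χ`,
`0 = Σ_h χ(h^{−1}) Σ_b g(b) ζ(k, bh/p) = [Σ_b χ(b) g(b)]·[p^k L(k, χ^{−1})]` and `L(k, χ^{−1}) ≠ 0`, so every
`Σ_b χ(b) g(b)` vanishes; then orthogonality of characters gives `g = 0` — the content of «`Det(B) = ± Π_χ p^k L(k,χ) ≠ 0.
Thus the matrix `B` is invertible» (Dedekind determinant, Lemma 3). [cite: GunRammurtyRath2011, proof of Theorem 4, Lemma 3 and Det(B) (pp. 1339–1341)] -/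
theorem eq_zero_of_forall_sum_twist_eq_zero {p : ℕ} [hp : Fact p.Prime] {k : ℕ} (hk : 2 ≤ k)
    {g : (ZMod p)ˣ → ℂ}
    (hg : ∀ h : (ZMod p)ˣ, ∑ b : (ZMod p)ˣ,
      g b * ((hurwitzValue k ((((b * h : (ZMod p)ˣ) : ZMod p).val : ℝ) / p) : ℝ) : ℂ) = 0) :
    g = 0 := by
  haveI : NeZero p := ⟨hp.out.ne_zero⟩
  set Z : (ZMod p)ˣ → ℂ := fun x => ((hurwitzValue k ((((x : ZMod p)).val : ℝ) / p) : ℝ) : ℂ) with hZ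
  -- Step 1: every character sum of `g` vanishes
  have hT : ∀ χ : DirichletCharacter ℂ p, ∑ b : (ZMod p)ˣ, χ (b : ZMod p) * g b = 0 := by
    intro χ
    -- the eigenvalue of `χ⁻¹`
    have hS : ∑ x : (ZMod p)ˣ, χ⁻¹ (x : ZMod p) * Z x ≠ 0 := by
      rw [hZ]
      simp only
      rw [sum_units_mul_hurwitzValue_eq_pow_mul_LFunction hk χ⁻¹]
      refine mul_ne_zero (pow_ne_zero _ (by exact_mod_cast hp.out.ne_zero)) ?_
      refine DirichletCharacter.LFunction_ne_zero_of_one_le_re χ⁻¹ (Or.inr ?_) ?_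
      · intro h
        have h1 := congrArg Complex.re h
        simp only [Complex.natCast_re, Complex.one_re] at h1
        have : k = 1 := by exact_mod_cast h1
        omega
      · simp only [Complex.natCast_re]
        exact_mod_cast (by omega : 1 ≤ k)
    -- `Σ_h χ⁻¹(h) Σ_b g(b) Z(bh) = (Σ_b χ(b) g(b)) · (Σ_x χ⁻¹(x) Z(x))`
    have h0 : ∑ h : (ZMod p)ˣ, χ⁻¹ (h : ZMod p) * ∑ b : (ZMod p)ˣ, g b * Z (b * h) = 0 := by
      refine Finset.sum_eq_zero fun h _ => ?_
      rw [hZ]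
      simp only
      rw [hg h, mul_zero]
    have hswap : ∑ h : (ZMod p)ˣ, χ⁻¹ (h : ZMod p) * ∑ b : (ZMod p)ˣ, g b * Z (b * h) =
        (∑ b : (ZMod p)ˣ, χ (b : ZMod p) * g b) * ∑ x : (ZMod p)ˣ, χ⁻¹ (x : ZMod p) * Z x := by
      calc ∑ h : (ZMod p)ˣ, χ⁻¹ (h : ZMod p) * ∑ b : (ZMod p)ˣ, g b * Z (b * h)
          = ∑ b : (ZMod p)ˣ, g b * ∑ h : (ZMod p)ˣ, χ⁻¹ (h : ZMod p) * Z (b * h) := by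
            simp only [Finset.mul_sum]
            rw [Finset.sum_comm]
            refine Finset.sum_congr rfl fun b _ => Finset.sum_congr rfl fun h _ => by ring
        _ = ∑ b : (ZMod p)ˣ, g b * (χ (b : ZMod p) * ∑ x : (ZMod p)ˣ, χ⁻¹ (x : ZMod p) * Z x) := by
            refine Finset.sum_congr rfl fun b _ => ?_
            congr 1
            -- reindex `x = b h`
            rw [Finset.mul_sum]
            refine Fintype.sum_bijective (fun h : (ZMod p)ˣ => b * h) (Group.mulLeft_bijective b)
              (fun h => χ⁻¹ (h : ZMod p) * Z (b * h)) (fun x => χ (b : ZMod p) * (χ⁻¹ (x : ZMod p) * Z x))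
              fun h => ?_
            have hb : χ (b : ZMod p) * χ⁻¹ (b : ZMod p) = 1 := by
              rw [MulChar.inv_apply', ← map_mul, ZMod.mul_inv_of_unit _ (Units.isUnit b), map_one]
            calc χ⁻¹ (h : ZMod p) * Z (b * h)
                = (χ (b : ZMod p) * χ⁻¹ (b : ZMod p)) * χ⁻¹ (h : ZMod p) * Z (b * h) := by rw [hb, one_mul]
              _ = χ (b : ZMod p) * (χ⁻¹ (((b * h : (ZMod p)ˣ)) : ZMod p) * Z (b * h)) := by
                  rw [Units.val_mul, map_mul]; ring
        _ = (∑ b : (ZMod p)ˣ, χ (b : ZMod p) * g b) * ∑ x : (ZMod p)ˣ, χ⁻¹ (x : ZMod p) * Z x := by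
            rw [Finset.sum_mul]
            refine Finset.sum_congr rfl fun b _ => by ring
    rw [hswap] at h0
    exact (mul_eq_zero.1 h0).resolve_right hS
  -- Step 2: orthogonality of characters
  funext a
  have horth := fun b : (ZMod p)ˣ =>
    DirichletCharacter.sum_char_inv_mul_char_eq ℂ (Units.isUnit a) (b : ZMod p)
  have hsum : ∑ χ : DirichletCharacter ℂ p, χ (a : ZMod p)⁻¹ * ∑ b : (ZMod p)ˣ, χ (b : ZMod p) * g b = 0 := by
    refine Finset.sum_eq_zero fun χ _ => ?_
    rw [hT χ, mul_zero]
  rw [show (∑ χ : DirichletCharacter ℂ p, χ (a : ZMod p)⁻¹ * ∑ b : (ZMod p)ˣ, χ (b : ZMod p) * g b) =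
      ∑ b : (ZMod p)ˣ, g b * ∑ χ : DirichletCharacter ℂ p, χ (a : ZMod p)⁻¹ * χ (b : ZMod p) by
    simp only [Finset.mul_sum]
    rw [Finset.sum_comm]
    refine Finset.sum_congr rfl fun b _ => Finset.sum_congr rfl fun χ _ => by ring] at hsum
  simp only [horth, Units.val_injective.eq_iff] at hsum
  rw [Finset.sum_eq_single a (fun b _ hb => by simp [Ne.symm hb]) (fun h => absurd (Finset.mem_univ a) h)]
    at hsum
  simp only [if_true, mul_eq_zero, Nat.cast_eq_zero] at hsum
  rcases hsum with h | h
  · exact h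
  · exact absurd h (Nat.totient_pos.2 hp.out.pos).ne'

/-! ### The step of Theorem 4 -/

/-- `Σ_{a ∈ [1, p)} G(a) = Σ_{u ∈ (ℤ/p)^×} G(val u)` for a prime `p`. [folklore] -/
private theorem sum_Ico_eq_sum_units {p : ℕ} [hp : Fact p.Prime] (G : ℕ → ℂ) :
    ∑ a ∈ Ico 1 p, G a = ∑ u : (ZMod p)ˣ, G (u : ZMod p).val := by
  refine (Finset.sum_bij (fun (u : (ZMod p)ˣ) _ => (u : ZMod p).val) (fun u _ => ?_) (fun u _ v _ h => ?_)
    (fun a ha => ?_) (fun u _ => rfl)).symm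
  · rw [Finset.mem_Ico]
    refine ⟨Nat.one_le_iff_ne_zero.2 fun h => u.ne_zero ((ZMod.val_eq_zero _).1 h), ZMod.val_lt _⟩
  · exact Units.val_injective (ZMod.val_injective p h)
  · obtain ⟨ha1, hap⟩ := Finset.mem_Ico.1 ha
    have hne : ((a : ℕ) : ZMod p) ≠ 0 := by
      intro h
      rw [ZMod.natCast_eq_zero_iff] at h
      exact absurd (Nat.le_of_dvd (by omega) h) (by omega)
    refine ⟨Units.mk0 _ hne, Finset.mem_univ _, ?_⟩
    simp only [Units.val_mk0, ZMod.val_natCast, Nat.mod_eq_of_lt hap]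

/-- **Gun–Murty–Rath 2011, the unconditional step of Theorem 4**: let `p` be prime, `k ≥ 2`, `f : ℤ/p → ℚ`, and suppose
that EVERY multiplicative twist `f_h(n) = f(nh^{−1})`, `h ∈ (ℤ/p)^×`, has `L(k, f_h) = 0`. Then
`f(1) = ⋯ = f(p−1) = f(p)/(1 − p^k)`, i.e. `f(a) = f(0)/(1 − p^k)` for every `a ≠ 0` («by the evaluation of the Dedekind
determinant … `B` is invertible and hence by the equation (4) … `f(a) + f(p)/(p^k − 1) = 0`»).
[cite: GunRammurtyRath2011, proof of Theorem 4, eq. (4) to the end (pp. 1340–1341)] -/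
theorem exceptional_of_forall_LFunction_twist_eq_zero {p : ℕ} [hp : Fact p.Prime] {k : ℕ} (hk : 2 ≤ k)
    (f : ZMod p → ℚ)
    (hL : ∀ h : (ZMod p)ˣ, ZMod.LFunction (fun j : ZMod p => ((f (j * ((h⁻¹ : (ZMod p)ˣ) : ZMod p)) : ℚ) : ℂ)) k = 0) :
    ∀ a : ZMod p, a ≠ 0 → f a = f 0 / (1 - (p : ℚ) ^ k) := by
  haveI : NeZero p := ⟨hp.out.ne_zero⟩
  have hp2 : 2 ≤ p := hp.out.two_le
  have hpk : (1 : ℚ) - (p : ℚ) ^ k ≠ 0 := by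
    have h : (1 : ℚ) < (p : ℚ) ^ k := one_lt_pow₀ (by exact_mod_cast hp2) (by omega)
    exact (sub_neg.mpr h).ne
  have hpkC : ((p : ℂ)) ^ k - 1 ≠ 0 := by
    have h : (1 : ℝ) < (p : ℝ) ^ k := one_lt_pow₀ (by exact_mod_cast hp2) (by omega)
    have h' : ((p : ℂ) ^ k - 1) = (((p : ℝ) ^ k - 1 : ℝ) : ℂ) := by push_cast; ring
    rw [h']
    exact_mod_cast (sub_pos.mpr h).ne'
  -- the vector `g(b) = f(b) + f(0)/(p^k − 1)` on the units
  set g : (ZMod p)ˣ → ℂ := fun b => ((f b : ℚ) : ℂ) + ((f 0 : ℚ) : ℂ) / ((p : ℂ) ^ k - 1) with hg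
  have hrows : ∀ h : (ZMod p)ˣ, ∑ b : (ZMod p)ˣ,
      g b * ((hurwitzValue k ((((b * h : (ZMod p)ˣ) : ZMod p).val : ℝ) / p) : ℝ) : ℂ) = 0 := by
    intro h
    have e := pow_mul_LFunction_eq_sum_Ico (N := p) hp2 hk
      (fun j : ZMod p => ((f (j * ((h⁻¹ : (ZMod p)ˣ) : ZMod p)) : ℚ) : ℂ))
    rw [hL h, mul_zero, sum_Ico_eq_sum_units, ← Equiv.sum_comp (Equiv.mulRight h)] at e
    refine Eq.trans (Finset.sum_congr rfl fun b _ => ?_) e.symm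
    simp only [Equiv.coe_mulRight, hg, ZMod.natCast_zmod_val, Units.val_mul, mul_assoc, Units.mul_inv,
      mul_one, zero_mul]
  have hg0 := eq_zero_of_forall_sum_twist_eq_zero hk hrows
  intro a ha
  have hu : IsUnit a := Ne.isUnit ha
  obtain ⟨u, rfl⟩ := hu
  have := congrFun hg0 u
  simp only [hg, Pi.zero_apply] at this
  -- `f(u) + f(0)/(p^k − 1) = 0` in `ℂ`, hence in `ℚ`
  have hq : (((f u + f 0 / ((p : ℚ) ^ k - 1) : ℚ)) : ℂ) = 0 := by push_cast; exact this
  have hq' : f u + f 0 / ((p : ℚ) ^ k - 1) = 0 := by exact_mod_cast hq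
  have hpk' : (p : ℚ) ^ k - 1 ≠ 0 := fun h => hpk (by linarith)
  field_simp at hq'
  field_simp
  linarith

/-- **The step of Theorem 4 as an equivalence**: for a prime `p`, `k ≥ 2` and `f : ℤ/p → ℚ`, ALL twists have
`L(k, f_h) = 0` iff `f` is the exceptional function `f(a) = f(0)/(1 − p^k)` (`a ≠ 0`) — the converse because every twist
of the exceptional function is the exceptional function, whose coefficients `f(a) + f(0)/(p^k − 1)` in the p. 1329 display
all vanish. [cite: GunRammurtyRath2011, proof of Theorem 4 (pp. 1340–1341) with the display of p. 1329] -/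
theorem forall_LFunction_twist_eq_zero_iff {p : ℕ} [hp : Fact p.Prime] {k : ℕ} (hk : 2 ≤ k) (f : ZMod p → ℚ) :
    (∀ h : (ZMod p)ˣ, ZMod.LFunction (fun j : ZMod p => ((f (j * ((h⁻¹ : (ZMod p)ˣ) : ZMod p)) : ℚ) : ℂ)) k = 0) ↔
      ∀ a : ZMod p, a ≠ 0 → f a = f 0 / (1 - (p : ℚ) ^ k) := by
  refine ⟨exceptional_of_forall_LFunction_twist_eq_zero hk f, fun hexc h => ?_⟩
  haveI : NeZero p := ⟨hp.out.ne_zero⟩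
  have hp2 : 2 ≤ p := hp.out.two_le
  have hp0 : (p : ℂ) ≠ 0 := by exact_mod_cast hp.out.ne_zero
  have hpkC : ((p : ℂ)) ^ k - 1 ≠ 0 := by
    have h1 : (1 : ℝ) < (p : ℝ) ^ k := one_lt_pow₀ (by exact_mod_cast hp2) (by omega)
    have h' : ((p : ℂ) ^ k - 1) = (((p : ℝ) ^ k - 1 : ℝ) : ℂ) := by push_cast; ring
    rw [h']
    exact_mod_cast (sub_pos.mpr h1).ne'
  have e := pow_mul_LFunction_eq_sum_Ico (N := p) hp2 hk (fun j : ZMod p => ((f (j * ((h⁻¹ : (ZMod p)ˣ) : ZMod p)) : ℚ) : ℂ))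
  have h1pk : (1 : ℂ) - (p : ℂ) ^ k ≠ 0 := fun h0 => hpkC (by linear_combination (-1 : ℂ) * h0)
  have hzero : ∑ a ∈ Ico 1 p, ((((f ((a : ZMod p) * ((h⁻¹ : (ZMod p)ˣ) : ZMod p)) : ℚ) : ℂ)) +
      (((f (0 * ((h⁻¹ : (ZMod p)ˣ) : ZMod p)) : ℚ) : ℂ)) / ((p : ℂ) ^ k - 1)) *
        ((hurwitzValue k ((a : ℝ) / p) : ℝ) : ℂ) = 0 := by
    refine Finset.sum_eq_zero fun a ha => ?_
    obtain ⟨ha1, hap⟩ := Finset.mem_Ico.1 ha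
    have hne : ((a : ℕ) : ZMod p) * ((h⁻¹ : (ZMod p)ˣ) : ZMod p) ≠ 0 := by
      refine mul_ne_zero ?_ (Units.ne_zero _)
      intro h0
      rw [ZMod.natCast_eq_zero_iff] at h0
      exact absurd (Nat.le_of_dvd (by omega) h0) (by omega)
    rw [zero_mul, hexc _ hne]
    have : (((f 0 / (1 - (p : ℚ) ^ k) : ℚ)) : ℂ) + (((f 0 : ℚ)) : ℂ) / ((p : ℂ) ^ k - 1) = 0 := by
      push_cast
      field_simp
      ring
    rw [this, zero_mul]
  rw [hzero] at e
  exact (mul_eq_zero.1 e).resolve_left (pow_ne_zero _ hp0)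

end Literature.NumberTheory.Irrationality.DirichletLValues

end
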